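import Summits.CriticalPhenomena.CardyFormulaZ2.Theses.CardyQContinuation
import Summits.CriticalPhenomena.CardyFormulaZ2.Theorems.CardyQContinuationIsingJetsConformalStubHigherJetLimitsConformal
import Literature.Probability.RandomPlanarGeometry.ImageUnivalent
import Literature.Probability.RandomPlanarGeometry.MarkedDomainCorners
import Literature.Probability.Percolation.SmirnovConformalProofs

/-!
# Crux `IsingJetsConformal`, stub `stub_higherJetCovariance`: transport of the marked boundary
# along a conformal equivalence of conformal rectangles (route `CardyQContinuation`,
# item stmt-CriticalPhenomena-5560)

The registered stub `stub_higherJetCovariance` of the reshaped skeleton asks, for `n ≥ 1`: if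
`Ψ : Ω → Ω'` is a conformal equivalence of the carriers of two conformal rectangles `R`, `R'`
with boundary value `R'.pt i` at `R.pt i` for the four marked points, then the `δ → 0⁺` limits
of the `n`-th `s`-jets at `s = √2` of the self-dual FK crossing ratios `P_δ` of `R` and `R'`
coincide. This is conformal COVARIANCE of the higher FK-Ising jet limits — new mathematics
(the continuum analogue of Chelkak–Smirnov's covariance of fermionic observables), NOT proved
here. This file proves, sorry-free, the geometric objects through which any covariance proof
transports the crossing event `(ab) ↔ (cd)` of `Ω` to that of `Ω'`, and the bookkeeping that
shows the reshaped cut loses no strength: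

* `isUniformizing_trans` (`stub_higherJetCovariance_isUniformizing_trans`, registered form): a
  uniformizing datum `(φ, x)` of `R` composed with a marked conformal equivalence `Ψ` is a
  uniformizing datum `(Ψ ∘ φ, x)` of `R'` with the SAME real quadruple; hence marked equivalence
  forces equal chirality and equal modulus (`orientation_iff_and_crossRatio_eq_of_hasBoundaryValue_pt`),
  and together with worker B's `exists_conformalEquiv_hasBoundaryValue_pt` (p144394):
  `R ≅ R'` as marked domains iff some (every) pair of uniformizing data has equal orientation
  and equal cross-ratio (`exists_conformalEquiv_hasBoundaryValue_pt_iff`);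
* `higherJetCovariance_of_crossRatioForm`: the planner's ORIGINAL third stub ("equal cross-ratio
  ⇒ equal jet limits") implies the reshaped stub `stub_higherJetCovariance` (uniformize `R`,
  transport the datum along `Ψ`); the skeleton proves the converse direction, so the reshaped
  cut is equivalent to the original one;
* `arc_eq_arc_of_pt_eq`: the arcs of a Jordan curve with `n ≥ 3` marked points are determined
  by the curve and the marked points (two markings of the same curve with the same marked points
  have the same closed arcs) — a connectedness argument: the open arc `(pᵢ pᵢ₊₁)` of the second
  marking is a connected subset of the curve missing all marked points, hence lies in a single
  closed arc of the first marking, whose only marked points are then `pᵢ`, `pᵢ₊₁`;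
* `exists_extension_arc_eq` (`stub_higherJetCovariance_arc_image`, registered form): the
  Carathéodory extension `Φ` of `Ψ` to `closure Ω` (tree:
  `JordanDomain.exists_extension_of_conformalEquiv`, from Pommerenke's Thm. 2.6) is a continuous
  bijection `closure Ω → closure Ω'` with `Φ(∂Ω) = ∂Ω'`, `Φ(R.pt i) = R'.pt i` and
  `Φ(R.arc i) = R'.arc i` for each `i : Fin 4` (apply `arc_eq_arc_of_pt_eq` to the image
  rectangle `MarkedDomain.image R Φ` and `R'`); consequently `Ψ⁻¹` has boundary value `R.pt i`
  at `R'.pt i` (`hasBoundaryValue_symm_pt`), i.e. marked equivalence is symmetric.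

Left for the stub (new mathematics): covariance of the jet limits themselves.

References: Ch. Pommerenke, *Boundary Behaviour of Conformal Maps* (1992), Thm. 2.6, Cor. 2.7;
L. V. Ahlfors, *Complex Analysis* (1979), Ch. 6 §1.1.
-/

namespace Summit.CriticalPhenomena.CardyFormulaZ2.Theorems.CardyQContinuation

open Filter Set Metric
open scoped Topology
open Literature.Probability.RandomPlanarGeometry
open UpperHalfPlane (upperHalfPlaneSet)

/-! ### Transport of uniformizing data along a marked conformal equivalence -/

/-- **Boundary values compose**: if `φ : U → V` has boundary value `p` at `x` and `Ψ : V → W`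
has boundary value `q` at `p`, then `Ψ ∘ φ` has boundary value `q` at `x` (`φ` maps `U` into
`V`, so `φ → p` within `V`). [folklore] -/
theorem hasBoundaryValue_trans {U V W : Set ℂ} (φ : ConformalEquiv U V) (Ψ : ConformalEquiv V W)
    {x p q : ℂ} (hφ : φ.HasBoundaryValue x p) (hΨ : Ψ.HasBoundaryValue p q) :
    (φ.trans Ψ).HasBoundaryValue x q :=
  hΨ.comp (tendsto_nhdsWithin_iff.2 ⟨hφ, eventually_nhdsWithin_of_forall fun _ hz ↦ φ.mapsTo hz⟩)

/-- **Transport of a uniformizing datum along a marked conformal equivalence.** If `(φ, x)`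
uniformizes the marked domain `D` and `Ψ : D → D'` is a conformal equivalence of the carriers
with boundary value `D'.pt i` at `D.pt i` for every marked point, then `(Ψ ∘ φ, x)` uniformizes
`D'` — with the same real boundary quadruple `x`. [cite: AhlforsCA1979, Ch. 6 §1.1] -/
theorem isUniformizing_trans {n : ℕ} {D D' : MarkedDomain n}
    {φ : ConformalEquiv upperHalfPlaneSet D.carrier} {x : Fin n → ℝ} (hφ : D.IsUniformizing φ x)
    (Ψ : ConformalEquiv D.carrier D'.carrier) (hΨ : ∀ i, Ψ.HasBoundaryValue (D.pt i) (D'.pt i)) :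
    D'.IsUniformizing (φ.trans Ψ) x :=
  ⟨hφ.1, fun i ↦ hasBoundaryValue_trans φ Ψ (hφ.2 i) (hΨ i)⟩

/-- **Registered form** (sub-goal `stub_higherJetCovariance_isUniformizing_trans` of stub
`stub_higherJetCovariance` of crux stmt-CriticalPhenomena-5560): transport of uniformizing data
of conformal rectangles along a marked conformal equivalence keeps the boundary quadruple
(`isUniformizing_trans`). [cite: AhlforsCA1979, Ch. 6 §1.1] -/
theorem stub_higherJetCovariance_isUniformizing_trans :
    ∀ (R R' : Literature.Probability.RandomPlanarGeometry.ConformalRectangle) (φ : Literature.Probability.RandomPlanarGeometry.ConformalEquiv UpperHalfPlane.upperHalfPlaneSet R.carrier) (x : Fin 4 → ℝ) (Ψ : Literature.Probability.RandomPlanarGeometry.ConformalEquiv R.carrier R'.carrier), R.IsUniformizing φ x → (∀ i : Fin 4, Ψ.HasBoundaryValue (R.pt i) (R'.pt i)) → R'.IsUniformizing (φ.trans Ψ) x :=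
  fun _ _ _ _ Ψ hφ hΨ ↦ isUniformizing_trans hφ Ψ hΨ

/-- **Marked equivalence forces equal chirality and equal modulus.** If `Ψ : Ω → Ω'` is a
conformal equivalence with boundary values `R.pt i ↦ R'.pt i`, then ANY uniformizing data
`(φ, x)` of `R` and `(φ', x')` of `R'` have the same orientation and the same cross-ratio:
`(Ψ ∘ φ, x)` and `(φ', x')` are two data of `R'` (`isUniformizing_trans`), so chirality
(`isUniformizing_strictMono_iff`) and the conformal modulus
(`ConformalRectangle.crossRatio_eq_of_isUniformizing_holds`) agree. [cite: AhlforsCA1979, Ch. 6 §1.1] -/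
theorem orientation_iff_and_crossRatio_eq_of_hasBoundaryValue_pt {R R' : ConformalRectangle}
    (Ψ : ConformalEquiv R.carrier R'.carrier) (hΨ : ∀ i, Ψ.HasBoundaryValue (R.pt i) (R'.pt i))
    {φ : ConformalEquiv upperHalfPlaneSet R.carrier} {x : Fin 4 → ℝ}
    {φ' : ConformalEquiv upperHalfPlaneSet R'.carrier} {x' : Fin 4 → ℝ}
    (hφ : R.IsUniformizing φ x) (hφ' : R'.IsUniformizing φ' x') :
    (StrictMono x ↔ StrictMono x') ∧ crossRatio x = crossRatio x' :=
  ⟨isUniformizing_strictMono_iff (isUniformizing_trans hφ Ψ hΨ) hφ',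
    ConformalRectangle.crossRatio_eq_of_isUniformizing_holds (isUniformizing_trans hφ Ψ hΨ) hφ'⟩

/-- **Marked equivalence ⇔ equal chirality and equal modulus.** For conformal rectangles with
uniformizing data `(φ, x)`, `(φ', x')`: a conformal equivalence `Ω → Ω'` with boundary values
`R.pt i ↦ R'.pt i` exists iff `x`, `x'` have the same orientation and the same cross-ratio
(`⇐` is worker B's `exists_conformalEquiv_hasBoundaryValue_pt`, `⇒` is
`orientation_iff_and_crossRatio_eq_of_hasBoundaryValue_pt`). [cite: AhlforsCA1979, Ch. 6 §1.1] -/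
theorem exists_conformalEquiv_hasBoundaryValue_pt_iff {R R' : ConformalRectangle}
    {φ : ConformalEquiv upperHalfPlaneSet R.carrier} {x : Fin 4 → ℝ}
    {φ' : ConformalEquiv upperHalfPlaneSet R'.carrier} {x' : Fin 4 → ℝ}
    (hφ : R.IsUniformizing φ x) (hφ' : R'.IsUniformizing φ' x') :
    (∃ Ψ : ConformalEquiv R.carrier R'.carrier, ∀ i, Ψ.HasBoundaryValue (R.pt i) (R'.pt i)) ↔
      (StrictMono x ↔ StrictMono x') ∧ crossRatio x = crossRatio x' :=
  ⟨fun ⟨Ψ, hΨ⟩ ↦ orientation_iff_and_crossRatio_eq_of_hasBoundaryValue_pt Ψ hΨ hφ hφ',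
    fun h ↦ exists_conformalEquiv_hasBoundaryValue_pt hφ hφ' h.1 h.2⟩

/-- **The original third stub implies the reshaped one.** The planner's stub
`stub_higherJetLimitsConformal` ("for `n ≥ 1`, uniformizing data of equal cross-ratio give equal
jet limits") implies `stub_higherJetCovariance` ("jet limits are invariant under marked
conformal equivalences"): uniformize `R` by `(φ, x)` (`MarkedDomain.exists_isUniformizing_holds`)
and transport the datum to `(Ψ ∘ φ, x)` on `R'` (`isUniformizing_trans`) — the same quadruple,
so trivially the same cross-ratio. The skeleton `IsingJetsConformal.lean` derives the converse
(`higherJetLimitsConformal_of`), so the reshaped cut is equivalent to the original.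
[cite: AhlforsCA1979, Ch. 6 §1.1] -/
theorem higherJetCovariance_of_crossRatioForm
    (h : (let w : Literature.Probability.RandomPlanarGeometry.ConformalRectangle → ℝ → ℂ → Set (Sym2 (Literature.Probability.LatticeModels.Site 2)) → ℂ := fun R δ s ω ↦ s ^ (ω.ncard + 2 * Nat.card ((Literature.Probability.Percolation.openGraph ω ⊔ Literature.Probability.LatticeModels.wired (Literature.Probability.LatticeModels.discreteArc R.carrier δ (R.arc 0) ∪ Literature.Probability.LatticeModels.discreteArc R.carrier δ (R.arc 2))).induce (Literature.Probability.LatticeModels.meshDomain R.carrier δ)).ConnectedComponent); let P : Literature.Probability.RandomPlanarGeometry.ConformalRectangle → ℝ → ℂ → ℂ := fun R δ s ↦ (∑ᶠ ω ∈ 𝒫 (Literature.Probability.LatticeModels.discreteDomainGraph R.carrier δ).edgeSet, (Literature.Probability.Percolation.discreteCrossing R.carrier δ (R.arc 0) (R.arc 2)).indicator (w R δ s) ω) / (∑ᶠ ω ∈ 𝒫 (Literature.Probability.LatticeModels.discreteDomainGraph R.carrier δ).edgeSet, w R δ s ω); ∀ n : ℕ, 1 ≤ n → ∀ (R R' : Literature.Probability.RandomPlanarGeometry.ConformalRectangle)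 (φ : Literature.Probability.RandomPlanarGeometry.ConformalEquiv UpperHalfPlane.upperHalfPlaneSet R.carrier) (x : Fin 4 → ℝ) (φ' : Literature.Probability.RandomPlanarGeometry.ConformalEquiv UpperHalfPlane.upperHalfPlaneSet R'.carrier) (x' : Fin 4 → ℝ) (L L' : ℂ), R.IsUniformizing φ x → R'.IsUniformizing φ' x' → Literature.Probability.RandomPlanarGeometry.crossRatio x = Literature.Probability.RandomPlanarGeometry.crossRatio x' → Filter.Tendsto (fun δ ↦ iteratedDeriv n (P R δ) (Real.sqrt 2 : ℂ)) (nhdsWithin 0 (Set.Ioi 0)) (nhds L) → Filter.Tendsto (fun δ ↦ iteratedDeriv n (P R' δ) (Real.sqrt 2 : ℂ)) (nhdsWithin 0 (Set.Ioi 0)) (nhds L') → L = L')) :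
    (let w : Literature.Probability.RandomPlanarGeometry.ConformalRectangle → ℝ → ℂ → Set (Sym2 (Literature.Probability.LatticeModels.Site 2)) → ℂ := fun R δ s ω ↦ s ^ (ω.ncard + 2 * Nat.card ((Literature.Probability.Percolation.openGraph ω ⊔ Literature.Probability.LatticeModels.wired (Literature.Probability.LatticeModels.discreteArc R.carrier δ (R.arc 0) ∪ Literature.Probability.LatticeModels.discreteArc R.carrier δ (R.arc 2))).induce (Literature.Probability.LatticeModels.meshDomain R.carrier δ)).ConnectedComponent); let P : Literature.Probability.RandomPlanarGeometry.ConformalRectangle → ℝ → ℂ → ℂ := fun R δ s ↦ (∑ᶠ ω ∈ 𝒫 (Literature.Probability.LatticeModels.discreteDomainGraph R.carrier δ).edgeSet, (Literature.Probability.Percolation.discreteCrossing R.carrier δ (R.arc 0) (R.arc 2)).indicator (w R δ s) ω) / (∑ᶠ ω ∈ 𝒫 (Literature.Probability.LatticeModels.discreteDomainGraph R.carrier δ).edgeSet, w R δ s ω); ∀ n : ℕ, 1 ≤ n → ∀ (R R' : Literature.Probability.RandomPlanarGeometry.ConformalRectangle) (Ψ : Literature.Probability.RandomPlanarGeometry.ConformalEquiv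 R.carrier R'.carrier), (∀ i : Fin 4, Ψ.HasBoundaryValue (R.pt i) (R'.pt i)) → ∀ (L L' : ℂ), Filter.Tendsto (fun δ ↦ iteratedDeriv n (P R δ) (Real.sqrt 2 : ℂ)) (nhdsWithin 0 (Set.Ioi 0)) (nhds L) → Filter.Tendsto (fun δ ↦ iteratedDeriv n (P R' δ) (Real.sqrt 2 : ℂ)) (nhdsWithin 0 (Set.Ioi 0)) (nhds L') → L = L') := by
  intro w P n hn R R' Ψ hΨ L L' hL hL'
  obtain ⟨φ, x, hφ⟩ := MarkedDomain.exists_isUniformizing_holds (n := 4) R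
  exact h n hn R R' φ x (φ.trans Ψ) x L L' hφ (isUniformizing_trans hφ Ψ hΨ) rfl hL hL'

/-! ### The arcs of a marked Jordan curve are determined by the curve and the marked points -/

/-- In `Fin n` with `n ≥ 3` one has `j + 1 + 1 ≠ j` (the indices `j`, `j + 1`, `j + 2` of three
consecutive marked points are distinct). [folklore] -/
theorem add_one_add_one_ne {n : ℕ} [NeZero n] (hn : 3 ≤ n) (j : Fin n) : j + 1 + 1 ≠ j := by
  intro h
  rw [add_assoc, add_eq_left] at h
  have h1 : ((1 : Fin n) + 1).val = (0 : Fin n).val := congrArg Fin.val h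
  rw [Fin.val_add, Fin.val_one', Fin.val_zero, Nat.mod_eq_of_lt (show 1 < n by omega),
    Nat.mod_eq_of_lt (show 1 + 1 < n by omega)] at h1
  omega

/-- **The arcs of a marked Jordan curve are determined by the curve and the marked points**
(one inclusion). Let `D`, `D'` be Jordan domains with `n ≥ 3` marked points, with the same
boundary curve `∂D' = ∂D` and the same marked points `D'.pt = D.pt` (but possibly different
parametrisations, e.g. of opposite orientations). Then `D'.arc i ⊆ D.arc i`. Proof: the open
arc `O = D'.boundary (mark i, nextMark i)` is connected, lies on `∂D = ⋃ⱼ D.arc j` and contains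
no marked point; two distinct arcs of `D` meet only in marked points, so `O` lies in a single
closed arc `D.arc j` (a connected set covered by finitely many closed sets pairwise disjoint on
it); taking closures, `D.pt i, D.pt (i+1) ∈ D.arc j`, whence `j = i` as `n ≥ 3`. [folklore] -/
theorem arc_subset_arc_of_pt_eq {n : ℕ} [NeZero n] (hn : 3 ≤ n) {D D' : MarkedDomain n}
    (hF : frontier D'.carrier = frontier D.carrier) (hpt : ∀ m, D'.pt m = D.pt m) (i : Fin n) :
    D'.arc i ⊆ D.arc i := by
  have h1n : 1 < n := by omega
  -- the open arc of `D'` from `pt i` to `pt (i + 1)`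
  set O : Set ℂ := D'.boundary '' Ioo (D'.mark i) (D'.nextMark i) with hO
  have hOarc : O ⊆ D'.arc i := image_mono Ioo_subset_Icc_self
  have hOfr : O ⊆ ⋃ j, D.arc j := by
    rw [D.iUnion_arc_holds, ← hF]
    exact hOarc.trans (D'.arc_subset_frontier i)
  -- no marked point lies on the open arc
  have hOpt : ∀ m, D.pt m ∉ O := fun m hm ↦ by
    rw [← hpt] at hm
    rcases D'.pt_mem_arc_iff.1 (hOarc hm) with rfl | rfl
    · exact D'.pt_notMem_image_Ioo h1n _ hm
    · exact D'.pt_succ_notMem_image_Ioo h1n _ hm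
  -- a common point of two distinct arcs of `D` is a marked point, hence is not on `O`
  have hmeet : ∀ {j k : Fin n} {q : ℂ}, k ≠ j → q ∈ D.arc j → q ∈ D.arc k → q ∉ O :=
    fun {j k q} hkj hqj hqk hqO ↦ by
      rcases D.mem_arc_inter_arc hkj hqj hqk with h | h
      · exact hOpt j (h ▸ hqO)
      · exact hOpt (j + 1) (h ▸ hqO)
  -- a point of the open arc and an arc of `D` through it
  obtain ⟨p, hp⟩ : O.Nonempty := ⟨_, mem_image_of_mem _ (D'.midpoint_mem_Ioo i)⟩
  obtain ⟨j, hj⟩ := mem_iUnion.1 (hOfr hp)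
  -- Step A: the whole open arc lies in `D.arc j`
  have hOj : O ⊆ D.arc j := by
    set v : Set ℂ := ⋃ k ∈ {k : Fin n | k ≠ j}, D.arc k with hv
    have hvc : IsClosed v := (Set.toFinite _).isClosed_biUnion fun k _ ↦ D.isClosed_arc k
    have hmemv : ∀ {q : ℂ}, q ∈ v ↔ ∃ k, k ≠ j ∧ q ∈ D.arc k := fun {q} ↦ by
      simp only [hv, mem_iUnion, mem_setOf_eq, exists_prop]
    have hsub : O ⊆ D.arc j ∪ v := fun q hq ↦ by
      obtain ⟨k, hk⟩ := mem_iUnion.1 (hOfr hq)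
      by_cases hkj : k = j
      · exact Or.inl (hkj ▸ hk)
      · exact Or.inr (hmemv.2 ⟨k, hkj, hk⟩)
    have hdisj : O ∩ (D.arc j ∩ v) = ∅ := by
      refine eq_empty_of_forall_notMem fun q ⟨hqO, hqj, hqv⟩ ↦ ?_
      obtain ⟨k, hkj, hqk⟩ := hmemv.1 hqv
      exact hmeet hkj hqj hqk hqO
    rcases isPreconnected_iff_subset_of_disjoint_closed.1 (D'.isPreconnected_image_Ioo i)
      (D.arc j) v (D.isClosed_arc j) hvc hsub hdisj with h | h
    · exact h
    · obtain ⟨k, hkj, hpk⟩ := hmemv.1 (h hp)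
      exact absurd hp (hmeet hkj hj hpk)
  -- Step B: pass to the closed arc; its end points force `j = i`
  have hcl : D'.arc i ⊆ D.arc j :=
    (D'.arc_subset_closure_image_Ioo i).trans (closure_minimal hOj (D.isClosed_arc j))
  have hi : D.pt i ∈ D.arc j := hpt i ▸ hcl (D'.pt_mem_arc_self i)
  have hi1 : D.pt (i + 1) ∈ D.arc j := hpt (i + 1) ▸ hcl (D'.pt_succ_mem_arc i)
  obtain rfl : i = j := by
    rcases D.pt_mem_arc_iff.1 hi with h | h
    · exact h
    · rcases D.pt_mem_arc_iff.1 hi1 with h' | h'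
      · rw [h] at h'
        exact absurd h' (add_one_add_one_ne hn j)
      · exact add_right_cancel h'
  exact hcl

/-- **The arcs of a marked Jordan curve are determined by the curve and the marked points**:
two Jordan domains with `n ≥ 3` marked points, the same boundary curve and the same marked
points have the same closed boundary arcs `arc i`, `i : Fin n` (both inclusions of
`arc_subset_arc_of_pt_eq`). For `n = 2` this fails (the two arcs may be exchanged); three
marked points pin down the orientation. [folklore] -/
theorem arc_eq_arc_of_pt_eq {n : ℕ} [NeZero n] (hn : 3 ≤ n) {D D' : MarkedDomain n}
    (hF : frontier D.carrier = frontier D'.carrier) (hpt : ∀ m, D.pt m = D'.pt m) (i : Fin n) :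
    D.arc i = D'.arc i :=
  (arc_subset_arc_of_pt_eq hn hF hpt i).antisymm
    (arc_subset_arc_of_pt_eq hn hF.symm (fun m ↦ (hpt m).symm) i)

/-! ### Carathéodory: the homeomorphic extension of a marked conformal equivalence -/

/-- **Transport of the marked boundary along a conformal equivalence of conformal rectangles**
(Carathéodory). Let `Ψ : Ω → Ω'` be a conformal equivalence of the carriers of conformal
rectangles `R`, `R'` with boundary value `R'.pt i` at `R.pt i` for the four marked points. Then
the continuous extension `Φ` of `Ψ` to `closure Ω` (Pommerenke (1992), Thm. 2.6 / Cor. 2.7, tree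
`JordanDomain.exists_extension_of_conformalEquiv`) is a continuous bijection
`closure Ω → closure Ω'` with `Φ(∂Ω) = ∂Ω'`, `Φ(R.pt i) = R'.pt i`, and it carries each closed
boundary arc onto the corresponding arc: `Φ(R.arc i) = R'.arc i`. The last point: the image
rectangle `Φ(R)` (`MarkedDomain.image`) has the carrier, hence the boundary curve, and the
marked points of `R'`, so the same arcs (`arc_eq_arc_of_pt_eq`). [cite: PommerenkeBBCM1992, Thm. 2.6] -/
theorem exists_extension_arc_eq {R R' : ConformalRectangle} (Ψ : ConformalEquiv R.carrier R'.carrier)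
    (hΨ : ∀ i, Ψ.HasBoundaryValue (R.pt i) (R'.pt i)) :
    ∃ Φ : ℂ → ℂ, ContinuousOn Φ (closure R.carrier) ∧ EqOn Φ Ψ R.carrier ∧
      BijOn Φ (closure R.carrier) (closure R'.carrier) ∧
      Φ '' frontier R.carrier = frontier R'.carrier ∧
      (∀ i, Φ (R.pt i) = R'.pt i) ∧ ∀ i, Φ '' R.arc i = R'.arc i := by
  obtain ⟨Φ, hΦc, hΦeq, hbij, -⟩ := JordanDomain.exists_extension_of_conformalEquiv
    JordanDomain.exists_continuousOn_extension_holds R.toJordanDomain R'.toJordanDomain Ψ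
  have hinj : InjOn Φ (closure R.carrier) := hbij.injOn
  -- the image rectangle `Φ(R)` has the carrier and the marked points of `R'`
  have hcar : (MarkedDomain.image R Φ hΦc hinj).carrier = R'.carrier := by
    rw [MarkedDomain.carrier_image, hΦeq.image_eq]
    exact Ψ.bijOn.image_eq
  have hpt : ∀ i, Φ (R.pt i) = R'.pt i := fun i ↦
    JordanDomain.extension_apply_eq_of_hasBoundaryValue hΦc hΦeq
      (frontier_subset_closure (R.pt_mem_frontier i)) (hΨ i)
  have hSpt : ∀ i, (MarkedDomain.image R Φ hΦc hinj).pt i = R'.pt i := fun i ↦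
    (MarkedDomain.pt_image R Φ hΦc hinj i).trans (hpt i)
  have hfr : Φ '' frontier R.carrier = frontier R'.carrier :=
    (MarkedDomain.frontier_carrier_image R Φ hΦc hinj).symm.trans (congrArg frontier hcar)
  have harc : ∀ i, Φ '' R.arc i = R'.arc i := fun i ↦ by
    rw [← MarkedDomain.arc_image R Φ hΦc hinj i]
    exact arc_eq_arc_of_pt_eq (by norm_num) (congrArg frontier hcar) hSpt i
  exact ⟨Φ, hΦc, hΦeq, hbij, hfr, hpt, harc⟩

/-- **Registered form** (sub-goal `stub_higherJetCovariance_arc_image` of stub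
`stub_higherJetCovariance` of crux stmt-CriticalPhenomena-5560): the Carathéodory transport of
the marked boundary of a conformal rectangle along a marked conformal equivalence
(`exists_extension_arc_eq`). [cite: PommerenkeBBCM1992, Thm. 2.6] -/
theorem stub_higherJetCovariance_arc_image :
    ∀ (R R' : Literature.Probability.RandomPlanarGeometry.ConformalRectangle) (Ψ : Literature.Probability.RandomPlanarGeometry.ConformalEquiv R.carrier R'.carrier), (∀ i : Fin 4, Ψ.HasBoundaryValue (R.pt i) (R'.pt i)) → ∃ Φ : ℂ → ℂ, ContinuousOn Φ (closure R.carrier) ∧ Set.EqOn Φ Ψ R.carrier ∧ Set.BijOn Φ (closure R.carrier) (closure R'.carrier) ∧ Φ '' frontier R.carrier = frontier R'.carrier ∧ (∀ i : Fin 4, Φ (R.pt i) = R'.pt i) ∧ ∀ i : Fin 4, Φ '' R.arc i = R'.arc i :=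
  fun _ _ Ψ hΨ ↦ exists_extension_arc_eq Ψ hΨ

/-- **The complementary boundary is transported too.** For `Φ` injective on `closure Ω` with
`Φ(∂Ω) = ∂Ω'` and `Φ(R.arc i) = R'.arc i` (as in `exists_extension_arc_eq`), also
`Φ(∂Ω ∖ R.arc i) = ∂Ω' ∖ R'.arc i`: the second set entering G02's discrete arcs
`LatticeModels.discreteArc Ω δ A` (boundary vertices at least as close to `A` as to `∂Ω ∖ A`).
[folklore] -/
theorem image_frontier_diff_arc {R R' : ConformalRectangle} {Φ : ℂ → ℂ}
    (hinj : InjOn Φ (closure R.carrier)) (hfr : Φ '' frontier R.carrier = frontier R'.carrier)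
    {i : Fin 4} (harc : Φ '' R.arc i = R'.arc i) :
    Φ '' (frontier R.carrier \ R.arc i) = frontier R'.carrier \ R'.arc i := by
  rw [(hinj.mono frontier_subset_closure).image_sdiff_subset (R.arc_subset_frontier i), hfr, harc]

/-- **The extension is a homeomorphism of the closures**: for `Φ` continuous on `closure Ω`,
equal to `Ψ` on `Ω` and bijective `closure Ω → closure Ω'` (as in `exists_extension_arc_eq`),
the inverse `Function.invFunOn Φ (closure Ω)` is continuous on `closure Ω'` (continuous
bijection of a compact set, `continuousOn_invFunOn_of_isCompact`) and agrees with `Ψ⁻¹` on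
`Ω'`. [cite: PommerenkeBBCM1992, Thm. 2.6] -/
theorem continuousOn_invFunOn_extension {R R' : ConformalRectangle}
    (Ψ : ConformalEquiv R.carrier R'.carrier) {Φ : ℂ → ℂ}
    (hΦc : ContinuousOn Φ (closure R.carrier)) (hΦeq : EqOn Φ Ψ R.carrier)
    (hbij : BijOn Φ (closure R.carrier) (closure R'.carrier)) :
    ContinuousOn (Function.invFunOn Φ (closure R.carrier)) (closure R'.carrier) ∧
      EqOn (Function.invFunOn Φ (closure R.carrier)) Ψ.symm R'.carrier := by
  refine ⟨continuousOn_invFunOn_of_isCompact R.isBounded.isCompact_closure hΦc hbij,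
    fun w hw ↦ ?_⟩
  have h1 : Φ (Function.invFunOn Φ (closure R.carrier) w) = w :=
    hbij.invOn_invFunOn.2 (subset_closure hw)
  have h2 : Φ (Ψ.symm w) = w := by rw [hΦeq (Ψ.symm_mapsTo hw), Ψ.apply_symm_apply hw]
  exact hbij.injOn (hbij.surjOn.mapsTo_invFunOn (subset_closure hw))
    (subset_closure (Ψ.symm_mapsTo hw)) (h1.trans h2.symm)

/-- **The extension is the boundary extension of `Ψ`**: any continuous extension `Φ` of `Ψ` to
`closure Ω` agrees there with `Ψ.boundaryExtension = extendFrom Ω Ψ`, and `Ψ` has boundary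
value `Φ x` at every `x ∈ closure Ω`. [folklore] -/
theorem hasBoundaryValue_of_extension {U V : Set ℂ} (Ψ : ConformalEquiv U V) {Φ : ℂ → ℂ}
    (hΦc : ContinuousOn Φ (closure U)) (hΦeq : EqOn Φ Ψ U) {x : ℂ} (hx : x ∈ closure U) :
    Ψ.HasBoundaryValue x (Φ x) ∧ Ψ.boundaryExtension x = Φ x := by
  have h : Ψ.HasBoundaryValue x (Φ x) :=
    (((hΦc x hx).mono subset_closure).tendsto).congr' (eventuallyEq_nhdsWithin_of_eqOn hΦeq)
  exact ⟨h, Ψ.boundaryExtension_eq_of_hasBoundaryValue hx h⟩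

/-- **Marked equivalence is symmetric**: if the conformal equivalence `Ψ : Ω → Ω'` has boundary
values `R.pt i ↦ R'.pt i` at the four marked points, then `Ψ⁻¹ : Ω' → Ω` has boundary values
`R'.pt i ↦ R.pt i`. (`Ψ⁻¹ = Φ⁻¹` on `Ω'` for the Carathéodory extension `Φ` of
`exists_extension_arc_eq`, a continuous injection of the compact `closure Ω`, so `Ψ⁻¹ w → R.pt i`
as `Φ (Ψ⁻¹ w) = w → R'.pt i = Φ (R.pt i)`.) [cite: PommerenkeBBCM1992, Thm. 2.6] -/
theorem hasBoundaryValue_symm_pt {R R' : ConformalRectangle} (Ψ : ConformalEquiv R.carrier R'.carrier)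
    (hΨ : ∀ i, Ψ.HasBoundaryValue (R.pt i) (R'.pt i)) (i : Fin 4) :
    Ψ.symm.HasBoundaryValue (R'.pt i) (R.pt i) := by
  obtain ⟨Φ, hΦc, hΦeq, hbij, -, hpt, -⟩ := exists_extension_arc_eq Ψ hΨ
  have hK : IsCompact (closure R.carrier) := R.isBounded.isCompact_closure
  have hg : ∀ᶠ w in 𝓝[R'.carrier] (R'.pt i), Ψ.symm w ∈ closure R.carrier :=
    eventually_nhdsWithin_of_forall fun w hw ↦ subset_closure (Ψ.symm_mapsTo hw)
  have hζ : R.pt i ∈ closure R.carrier := frontier_subset_closure (R.pt_mem_frontier i)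
  unfold ConformalEquiv.HasBoundaryValue
  refine tendsto_of_injOn_of_tendsto_comp hK hΦc hbij.injOn hg hζ ?_
  rw [hpt i]
  have hev : (Φ ∘ Ψ.symm) =ᶠ[𝓝[R'.carrier] (R'.pt i)] id :=
    eventually_nhdsWithin_of_forall fun w hw ↦ by
      simp only [Function.comp_apply, id]
      rw [hΦeq (Ψ.symm_mapsTo hw), Ψ.apply_symm_apply hw]
  exact (tendsto_id.mono_left nhdsWithin_le_nhds).congr' hev.symm

/-- **Marked equivalence is an equivalence relation on conformal rectangles** (symmetry, in the
shape of the stub's hypothesis): from `Ψ` with `∀ i, Ψ.HasBoundaryValue (R.pt i) (R'.pt i)` we get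
`Ψ.symm` with `∀ i, Ψ.symm.HasBoundaryValue (R'.pt i) (R.pt i)`; so in `stub_higherJetCovariance`
the roles of `R` and `R'` may be exchanged. [cite: PommerenkeBBCM1992, Thm. 2.6] -/
theorem exists_hasBoundaryValue_pt_symm {R R' : ConformalRectangle}
    (h : ∃ Ψ : ConformalEquiv R.carrier R'.carrier, ∀ i, Ψ.HasBoundaryValue (R.pt i) (R'.pt i)) :
    ∃ Ψ' : ConformalEquiv R'.carrier R.carrier, ∀ i, Ψ'.HasBoundaryValue (R'.pt i) (R.pt i) := by
  obtain ⟨Ψ, hΨ⟩ := h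
  exact ⟨Ψ.symm, hasBoundaryValue_symm_pt Ψ hΨ⟩

end Summit.CriticalPhenomena.CardyFormulaZ2.Theorems.CardyQContinuation
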